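import Summits.BirchSwinnertonDyer.Rank1Residual.Supersingular.SignedRankOneCorA5
import Summits.BirchSwinnertonDyer.Rank1Residual.Supersingular.TowerSurjectivitySemistable
import HarnessLib

/-!
# X7 / X6 (`a_p = 0`, Kobayashi ±) without Wuthrich's Lemma 20: the rank-one per-pair chain with the
# `p`-adic tower as hypothesis, and from surj(p) + (`p ≥ 5` ∨ (ram)) — classes X7/X6, joint A/B
# (cell `b2b-bsdres`, supersingular family, prover B = unit `b2b-bsdres-additive-p3`, gen 16)

HONEST FRAMING (run/shared/lean/b2b/bsd-rank1-residual/, verbatim in every file): the goal of the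
cell is to DELETE the COMBINATION-SHAPED residual classes of the Birch–Swinnerton-Dyer formula for
ALL analytic-rank `≤ 1` elliptic curves over `ℚ` — "full BSD formula for every rank `≤ 1` curve in
class `C`" assembled STRICTLY from published theorems — so that the rank-`≤ 1` remainder becomes
exactly the CONSTRUCTION-SHAPED classes, which are TYPED (missing-input `Prop`s), NOT attempted.
This is not "finishing BSD". THEOREMS ONLY; the named facts taken are the ones the originals take
(Kobayashi 2003 Thms. 1.2 / 4.1 = A94 / A98, the period-unit facts, GZK, modularity, the Cor. A.5
reading-fact A147) MINUS Wuthrich's Lemma 20 (A9); nothing about any particular curve asserted;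
X7 / X6 stay CONSTRUCTION-SHAPED; nothing is booked.

## What this file does (the X7/X6 half of the gen-16 binder swap; X8 half: `TowerSurjectivityOfRam.lean`)

The rank-one signed chain `kobayashiMainConjecture_of_cert_at_conductor_of_analyticRank_eq_one` →
`kobayashiMainConjecture_neg_one/one_of_mazurTate_…` → `bsdp_of_mazurTate_odd/even_of_corA5_…` /
`X7.…` uses Lemma 20 (`hL20`) only through `surjective_pow_of_surj_of_good` to produce the tower
`∀ m, ρ̄_{E,p^m}` onto for Kobayashi's Thm. 4.1 (A98, `n = 0` under `p`-adic surjectivity). Here: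

* `kobayashiMainConjecture_of_cert_at_conductor_of_analyticRank_eq_one_of_tower` — the same proof
  with the tower as a HYPOTHESIS (`htower`); `…_neg_one/one_of_mazurTate_…_of_tower`;
  `bsdp_of_mazurTate_odd/even_of_corA5_of_analyticRank_eq_one_of_tower` (every other input a named
  fact, as in `SignedRankOneCorA5.lean`).
* `towerSurj_of_surj_of_five_le_or_ram` — the tower from surj(p) and (`5 ≤ p` — Serre's lemma,
  tree theorem `serre_hasSurjectiveModNGaloisRep_pow_holds` — or `Ram W p` — Serre's transvection
  lifting, `towerSurj_of_surj_of_ram`); so at `p = 3` the census bit (ram@3) replaces Lemma 20.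
* `X7.bsdp_of_mazurTate_odd/even_of_corA5_…_of_ram`, `X6.…` readings.

READING: at `p ≥ 5` nothing changes (Serre); at `p = 3` (X7@3 with `a_3 = 0`, and X6@3) the A9
binder is replaced by (ram@3) = "some `ℓ ‖ N` with `3 ∤ ord_ℓ(Δ_min)`" — for semistable curves (X6) a
THEOREM modulo `hmod` + Ribet–Diamond (`ram_of_semistable_of_irr_of_le_seven`, cf.
`TowerSurjectivitySemistable.lean`), for X7 a decidable census bit.

References: [Kobayashi2003] Thm. 1.2, 4.1, 7.4; [BurungaleKobayashiOta2023] App. A Cor. A.5;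
[SerreAbelianLadic1968] IV §3.4, A.1.2; [Wuthrich2014] Lemma 20 (p. 399); [Pollack2003] Prop. 6.9–6.18.
-/

set_option autoImplicit false

noncomputable section

open scoped Classical MatrixGroups ModularForm

open CongruenceSubgroup WeierstrassCurve Literature.NumberTheory.EllipticCurves
  Literature.NumberTheory.EllipticCurves.ModularForms
  Literature.NumberTheory.EllipticCurves.Rank1Residual
  Literature.NumberTheory.EllipticCurves.Rank1Residual.Typed
  Literature.NumberTheory.EllipticCurves.Sprung2017
  Literature.NumberTheory.EllipticCurves.Kobayashi2003 ZpExtension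
  Literature.NumberTheory.EllipticCurves.BurungaleKobayashiOta2024
  Summit.BirchSwinnertonDyer.Rank1Residual.X1.MuLambda

namespace Summit.BirchSwinnertonDyer.Rank1Residual.Supersingular

/-! ### The tower from surj(p) and (`p ≥ 5` ∨ (ram)) -/

section Tower

variable (W : WeierstrassCurve ℚ) [W.IsElliptic] [W.IsGloballyMinimal] (p : ℕ) [Fact p.Prime]

/-- **surj(p) ∧ (`5 ≤ p` ∨ (ram)) ⟹ every `ρ̄_{E,pⁿ}` is onto**: Serre's lemma for `p ≥ 5`
(`serre_hasSurjectiveModNGaloisRep_pow_holds`), Serre's transvection lifting from a multiplicative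
prime with `p ∤ v_ℓ(Δ_min)` otherwise (`towerSurj_of_surj_of_ram`) — no Lemma 20.
[cite: SerreAbelianLadic1968, Ch. IV §3.4, Lemma 3 (IV-23) and A.1.2] -/
theorem towerSurj_of_surj_of_five_le_or_ram (hs : Surj W p) (h : 5 ≤ p ∨ Ram W p) (n : ℕ) :
    W.HasSurjectiveModNGaloisRep (p ^ n : ℕ) := by
  rcases h with hp5 | hram
  · exact serre_hasSurjectiveModNGaloisRep_pow_holds W p hp5 hs n
  · exact towerSurj_of_surj_of_ram W p hs hram n

end Tower

/-! ### The rank-one signed chain with the tower as hypothesis -/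

section Signed

variable (W : WeierstrassCurve ℚ) [W.IsElliptic] [W.IsGloballyMinimal] (p : ℕ) [Fact p.Prime]

/-- **Kobayashi's main conjecture for `(E, p, ε)` at a rank-one pair from a certificate AT THE
CONDUCTOR LEVEL, tower given** — `kobayashiMainConjecture_of_cert_at_conductor_of_analyticRank_eq_one`
(p214698) with `hL20`/`hs` replaced by the hypothesis `htower : ∀ m, ρ̄_{E,p^m}` onto (the only use
Lemma 20 had). `p` odd good, `a_p = 0`, `r_an = 1`; A94 (`h12`), A98 (`h41`), period-unit facts
(`h5`, `h3`), GZK by name; certificate `hcert₀` for the newform `f₀` of level `N_E`.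
[cite: Kobayashi2003, Thm. 1.2 (p. 2), Thm. 4.1 (p. 8) and Conjecture (p. 2)]
[cite: GreenbergVatsal2000, p. 4 and §3 Remark 3.4] -/
theorem kobayashiMainConjecture_of_cert_at_conductor_of_analyticRank_eq_one_of_tower
    (h12 : Kobayashi2003.thm12_signedSelmerDual_finite_torsion)
    (h41 : Kobayashi2003.thm41_signedCharIdeal_divisibility)
    (h5 : realPeriodRat_eq_unit_mul_plusPeriod) (h3 : realPeriodRat_eq_unit_mul_plusPeriod_three)
    (hGZK : rank_eq_analyticRank_of_analyticRank_le_one)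
    (hp : p ≠ 2) (hgood : W.HasGoodReductionAtPrime p) (hap : W.frobeniusTrace p = 0)
    (htower : ∀ m : ℕ, W.HasSurjectiveModNGaloisRep (p ^ m : ℕ)) (h1 : W.analyticRank = 1) (ε : ℤˣ)
    [NeZero (W.conductorNorm ℤ)] {f₀ : CuspForm (Gamma0 (W.conductorNorm ℤ)) 2} (hf₀ : IsNewformOf W f₀)
    (hcert₀ : ∀ L : IwasawaAlgebra p, IsSignedPAdicLFunction f₀ p ε L → mu L = 0 ∧ lam L = 1) :
    KobayashiMainConjecture W p ε := by
  intro κ γ hκ hγ hγ' _ f hf ϖ hϖ Lplus Lminus hPP D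
  -- the newform of the quantifier is `f₀`
  have hff : f = f₀ := hf.unique hf₀
  subst hff
  -- Thm. 1.2: `X^ε` finitely generated and torsion
  haveI : Module.Finite (IwasawaAlgebra p) D.X := h12.moduleFinite hp hgood hap hκ hγ D
  have hX : Module.IsTorsion (IwasawaAlgebra p) D.X := h12.isTorsion hp hgood hap hκ hγ D
  refine ⟨hX, ?_⟩
  obtain ⟨ξ, hξ⟩ := (charIdeal_isPrincipal_holds p D.X).principal
  have hξ' : D.charIdeal = Ideal.span {ξ} := hξ
  set L := kobayashiL ε Lplus Lminus with hL_def
  have hL : IsSignedPAdicLFunction f p ε L := hPP.isSignedPAdicLFunction_kobayashiL ε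
  -- (MC↑), integral, under the GIVEN tower
  have hU : ξ ∣ L := h41.dvd_of_charIdeal_eq_span hp hgood hap hf hκ hγ hγ' hL D hX htower hξ'
  have hC := D.X_pow_mordellWeilRank_dvd_of_charIdeal_eq_span hγ hX hξ'
  have hrank : W.mordellWeilRank = 1 := (hGZK W (by omega)).1.trans h1
  rw [hrank, pow_one] at hC
  obtain ⟨hμ, hlam⟩ := hcert₀ L hL
  have hspan : Ideal.span ({ξ} : Set (IwasawaAlgebra p)) = Ideal.span {L} :=
    span_eq_span_of_dvd_of_X_dvd_of_lam_eq_one hU hC hμ hlam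
  have hirr : W.HasIrreducibleModPGaloisRep p :=
    hasIrreducibleModPGaloisRep_of_dvd_frobeniusTrace W p hp
      (W.not_dvd_minimalDiscriminantInt_of_hasGoodReductionAtPrime' p hgood) (by rw [hap]; exact dvd_zero _)
  have hvϖ : padicValRat p ϖ = 0 := padicValRat_periodRatio_eq_zero h5 h3 W p hp hgood hirr f hf ϖ hϖ
  have hϖ0 : ϖ ≠ 0 := by
    intro h0
    rw [h0, Rat.cast_zero, zero_mul] at hϖ
    exact (IsNewform0.plusPeriod_pos_holds hf.1 hf.coeffField_eq_bot).ne' hϖ.symm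
  obtain ⟨u, hu⟩ := exists_units_coe_eq_ratCast hϖ0 hvϖ
  obtain ⟨hspan', hι⟩ := span_C_units_mul_eq u L
  refine ⟨PowerSeries.C (u : ℤ_[p]) * L, ?_, ?_⟩
  · rw [hξ', hspan, hspan']
  · rw [hι, hu]

/-- **Kobayashi's main conjecture for `(E, p, −1)` at a rank-one pair from ONE odd-level Mazur–Tate
certificate, tower given.** [cite: Kobayashi2003, Thm. 1.2, Thm. 4.1 and Conjecture (p. 2)]
[cite: Pollack2003, Prop. 6.9, 6.10 and 6.18] -/
theorem kobayashiMainConjecture_neg_one_of_mazurTate_of_analyticRank_eq_one_of_tower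
    (h12 : Kobayashi2003.thm12_signedSelmerDual_finite_torsion)
    (h41 : Kobayashi2003.thm41_signedCharIdeal_divisibility)
    (h5 : realPeriodRat_eq_unit_mul_plusPeriod) (h3 : realPeriodRat_eq_unit_mul_plusPeriod_three)
    (hGZK : rank_eq_analyticRank_of_analyticRank_le_one)
    (hp : p ≠ 2) (hgood : W.HasGoodReductionAtPrime p) (hap : W.frobeniusTrace p = 0)
    (htower : ∀ m : ℕ, W.HasSurjectiveModNGaloisRep (p ^ m : ℕ)) (h1 : W.analyticRank = 1)
    [NeZero (W.conductorNorm ℤ)] {f₀ : CuspForm (Gamma0 (W.conductorNorm ℤ)) 2} (hf₀ : IsNewformOf W f₀)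
    {n : ℕ} (hn : Odd n) {Θ : IwasawaAlgebra p}
    (hΘ : iwasawaToPowerSeries p Θ =
      ((mazurTateElement f₀ p n).map (algebraMap ℚ ℚ_[p]) : PowerSeries ℚ_[p]))
    (hΘ0 : Θ ≠ 0) (hμ : mu Θ = 0) (hlam : lam Θ = (cyclotomicOmegaPlus p n).natDegree + 1)
    (hlt : lam Θ < p ^ n) : KobayashiMainConjecture W p (-1) :=
  kobayashiMainConjecture_of_cert_at_conductor_of_analyticRank_eq_one_of_tower W p h12 h41 h5 h3 hGZK
    hp hgood hap htower h1 (-1) hf₀ fun _ hL ↦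
      lam_signed_neg_one_eq_of_mazurTate hp hf₀ hgood hap hL hn hΘ hΘ0 hμ hlam hlt

/-- **Kobayashi's main conjecture for `(E, p, 1)` at a rank-one pair from ONE even-level Mazur–Tate
certificate, tower given.** [cite: Kobayashi2003, Thm. 1.2, Thm. 4.1 and Conjecture (p. 2)]
[cite: Pollack2003, Prop. 6.9, 6.10 and 6.18] -/
theorem kobayashiMainConjecture_one_of_mazurTate_of_analyticRank_eq_one_of_tower
    (h12 : Kobayashi2003.thm12_signedSelmerDual_finite_torsion)
    (h41 : Kobayashi2003.thm41_signedCharIdeal_divisibility)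
    (h5 : realPeriodRat_eq_unit_mul_plusPeriod) (h3 : realPeriodRat_eq_unit_mul_plusPeriod_three)
    (hGZK : rank_eq_analyticRank_of_analyticRank_le_one)
    (hp : p ≠ 2) (hgood : W.HasGoodReductionAtPrime p) (hap : W.frobeniusTrace p = 0)
    (htower : ∀ m : ℕ, W.HasSurjectiveModNGaloisRep (p ^ m : ℕ)) (h1 : W.analyticRank = 1)
    [NeZero (W.conductorNorm ℤ)] {f₀ : CuspForm (Gamma0 (W.conductorNorm ℤ)) 2} (hf₀ : IsNewformOf W f₀)
    {n : ℕ} (hn : Even n) {Θ : IwasawaAlgebra p}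
    (hΘ : iwasawaToPowerSeries p Θ =
      ((mazurTateElement f₀ p n).map (algebraMap ℚ ℚ_[p]) : PowerSeries ℚ_[p]))
    (hΘ0 : Θ ≠ 0) (hμ : mu Θ = 0) (hlam : lam Θ = (cyclotomicOmegaMinus p n).natDegree + 1)
    (hlt : lam Θ < p ^ n) : KobayashiMainConjecture W p 1 :=
  kobayashiMainConjecture_of_cert_at_conductor_of_analyticRank_eq_one_of_tower W p h12 h41 h5 h3 hGZK
    hp hgood hap htower h1 1 hf₀ fun _ hL ↦
      lam_signed_one_eq_of_mazurTate hp hf₀ hgood hap hL hn hΘ hΘ0 hμ hlam hlt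

/-- **`a_p = 0`, odd good `p`, `r_an = 1`, sign `ε = −1`, tower given: `BSD(E,p)` from ONE odd-level
Mazur–Tate certificate, every other input a named fact** (A94, A98, period units, GZK, modularity,
the Cor. A.5 reading-fact A147) — `bsdp_of_mazurTate_odd_of_corA5_of_analyticRank_eq_one` without
Lemma 20. PER PAIR. [cite: BurungaleKobayashiOta2023, App. A Cor. A.5]
[cite: Kobayashi2003, Thm. 7.4, Thm. 1.2, Thm. 4.1 and Conjecture (p. 2)] [cite: Miller2011LMS, §1 and Def. 1.1] -/
theorem bsdp_of_mazurTate_odd_of_corA5_of_analyticRank_eq_one_of_tower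
    (h12 : Kobayashi2003.thm12_signedSelmerDual_finite_torsion)
    (h41 : Kobayashi2003.thm41_signedCharIdeal_divisibility)
    (h5 : realPeriodRat_eq_unit_mul_plusPeriod) (h3 : realPeriodRat_eq_unit_mul_plusPeriod_three)
    (hGZK : rank_eq_analyticRank_of_analyticRank_le_one) (hmod : hasEntireLFunction_rat)
    (hA5 : corA5_pPart_of_signedCharIdeal_eq)
    (hp : p ≠ 2) (hgood : W.HasGoodReductionAtPrime p) (hap : W.frobeniusTrace p = 0)
    (htower : ∀ m : ℕ, W.HasSurjectiveModNGaloisRep (p ^ m : ℕ)) (h1 : W.analyticRank = 1)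
    [NeZero (W.conductorNorm ℤ)] {f₀ : CuspForm (Gamma0 (W.conductorNorm ℤ)) 2} (hf₀ : IsNewformOf W f₀)
    {n : ℕ} (hn : Odd n) {Θ : IwasawaAlgebra p}
    (hΘ : iwasawaToPowerSeries p Θ =
      ((mazurTateElement f₀ p n).map (algebraMap ℚ ℚ_[p]) : PowerSeries ℚ_[p]))
    (hΘ0 : Θ ≠ 0) (hμ : mu Θ = 0) (hlam : lam Θ = (cyclotomicOmegaPlus p n).natDegree + 1)
    (hlt : lam Θ < p ^ n) : BSDp W p :=
  bsdp_of_kobayashiMainConjecture_of_corA5_of_analyticRank_eq_one W p hA5 hmod hGZK hp hgood hap h1 (-1)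
    (kobayashiMainConjecture_neg_one_of_mazurTate_of_analyticRank_eq_one_of_tower W p h12 h41 h5 h3 hGZK
      hp hgood hap htower h1 hf₀ hn hΘ hΘ0 hμ hlam hlt)

/-- **`a_p = 0`, odd good `p`, `r_an = 1`, sign `ε = 1`, tower given: `BSD(E,p)` from ONE even-level
Mazur–Tate certificate, every other input a named fact.** PER PAIR.
[cite: BurungaleKobayashiOta2023, App. A Cor. A.5] [cite: Kobayashi2003, Thm. 7.4, Thm. 1.2, Thm. 4.1 and Conjecture (p. 2)]
[cite: Miller2011LMS, §1 and Def. 1.1] -/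
theorem bsdp_of_mazurTate_even_of_corA5_of_analyticRank_eq_one_of_tower
    (h12 : Kobayashi2003.thm12_signedSelmerDual_finite_torsion)
    (h41 : Kobayashi2003.thm41_signedCharIdeal_divisibility)
    (h5 : realPeriodRat_eq_unit_mul_plusPeriod) (h3 : realPeriodRat_eq_unit_mul_plusPeriod_three)
    (hGZK : rank_eq_analyticRank_of_analyticRank_le_one) (hmod : hasEntireLFunction_rat)
    (hA5 : corA5_pPart_of_signedCharIdeal_eq)
    (hp : p ≠ 2) (hgood : W.HasGoodReductionAtPrime p) (hap : W.frobeniusTrace p = 0)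
    (htower : ∀ m : ℕ, W.HasSurjectiveModNGaloisRep (p ^ m : ℕ)) (h1 : W.analyticRank = 1)
    [NeZero (W.conductorNorm ℤ)] {f₀ : CuspForm (Gamma0 (W.conductorNorm ℤ)) 2} (hf₀ : IsNewformOf W f₀)
    {n : ℕ} (hn : Even n) {Θ : IwasawaAlgebra p}
    (hΘ : iwasawaToPowerSeries p Θ =
      ((mazurTateElement f₀ p n).map (algebraMap ℚ ℚ_[p]) : PowerSeries ℚ_[p]))
    (hΘ0 : Θ ≠ 0) (hμ : mu Θ = 0) (hlam : lam Θ = (cyclotomicOmegaMinus p n).natDegree + 1)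
    (hlt : lam Θ < p ^ n) : BSDp W p :=
  bsdp_of_kobayashiMainConjecture_of_corA5_of_analyticRank_eq_one W p hA5 hmod hGZK hp hgood hap h1 1
    (kobayashiMainConjecture_one_of_mazurTate_of_analyticRank_eq_one_of_tower W p h12 h41 h5 h3 hGZK
      hp hgood hap htower h1 hf₀ hn hΘ hΘ0 hμ hlam hlt)

end Signed

/-! ### Class readings: X7 from surj(p) + (`p ≥ 5` ∨ (ram)), X6 -/

section Classes

variable (W : WeierstrassCurve ℚ) [W.IsElliptic] [W.IsGloballyMinimal] (p : ℕ) [Fact p.Prime]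

/-- **X7 ∧ `r_an = 1` ∧ odd `p` ∧ `a_p = 0` ∧ surj(p) ∧ (`p ≥ 5` ∨ (ram)), sign `ε = −1`: `BSD(E,p)`
from ONE odd-level Mazur–Tate certificate, every other input a named fact — and NO Lemma 20** (at
`p ≥ 5` Serre; at `p = 3` the census bit (ram@3)). PER PAIR; X7 stays CONSTRUCTION-SHAPED; nothing
booked. [cite: BurungaleKobayashiOta2023, App. A Cor. A.5] [cite: Kobayashi2003, Thm. 7.4, Thm. 1.2, Thm. 4.1 and Conjecture (p. 2)]
[cite: SerreAbelianLadic1968, Ch. IV §3.4 and A.1.2] [cite: Miller2011LMS, §1 and Def. 1.1] -/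
theorem X7.bsdp_of_mazurTate_odd_of_corA5_of_analyticRank_eq_one_of_ram
    (h12 : Kobayashi2003.thm12_signedSelmerDual_finite_torsion)
    (h41 : Kobayashi2003.thm41_signedCharIdeal_divisibility)
    (h5 : realPeriodRat_eq_unit_mul_plusPeriod) (h3 : realPeriodRat_eq_unit_mul_plusPeriod_three)
    (hGZK : rank_eq_analyticRank_of_analyticRank_le_one) (hmod : hasEntireLFunction_rat)
    (hA5 : corA5_pPart_of_signedCharIdeal_eq)
    (hp : p ≠ 2) (hX : ClassX7 W p) (hap : W.frobeniusTrace p = 0) (hs : Surj W p)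
    (hram : 5 ≤ p ∨ Ram W p) (h1 : W.analyticRank = 1)
    [NeZero (W.conductorNorm ℤ)] {f₀ : CuspForm (Gamma0 (W.conductorNorm ℤ)) 2} (hf₀ : IsNewformOf W f₀)
    {n : ℕ} (hn : Odd n) {Θ : IwasawaAlgebra p}
    (hΘ : iwasawaToPowerSeries p Θ =
      ((mazurTateElement f₀ p n).map (algebraMap ℚ ℚ_[p]) : PowerSeries ℚ_[p]))
    (hΘ0 : Θ ≠ 0) (hμ : mu Θ = 0) (hlam : lam Θ = (cyclotomicOmegaPlus p n).natDegree + 1)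
    (hlt : lam Θ < p ^ n) : BSDp W p :=
  bsdp_of_mazurTate_odd_of_corA5_of_analyticRank_eq_one_of_tower W p h12 h41 h5 h3 hGZK hmod hA5 hp
    hX.1.1 hap (towerSurj_of_surj_of_five_le_or_ram W p hs hram) h1 hf₀ hn hΘ hΘ0 hμ hlam hlt

/-- **X7 ∧ `r_an = 1` ∧ odd `p` ∧ `a_p = 0` ∧ surj(p) ∧ (`p ≥ 5` ∨ (ram)), sign `ε = 1`: `BSD(E,p)`
from ONE even-level Mazur–Tate certificate, every other input a named fact, NO Lemma 20.** PER PAIR.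
[cite: BurungaleKobayashiOta2023, App. A Cor. A.5] [cite: Kobayashi2003, Thm. 7.4, Thm. 1.2, Thm. 4.1 and Conjecture (p. 2)]
[cite: SerreAbelianLadic1968, Ch. IV §3.4 and A.1.2] [cite: Miller2011LMS, §1 and Def. 1.1] -/
theorem X7.bsdp_of_mazurTate_even_of_corA5_of_analyticRank_eq_one_of_ram
    (h12 : Kobayashi2003.thm12_signedSelmerDual_finite_torsion)
    (h41 : Kobayashi2003.thm41_signedCharIdeal_divisibility)
    (h5 : realPeriodRat_eq_unit_mul_plusPeriod) (h3 : realPeriodRat_eq_unit_mul_plusPeriod_three)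
    (hGZK : rank_eq_analyticRank_of_analyticRank_le_one) (hmod : hasEntireLFunction_rat)
    (hA5 : corA5_pPart_of_signedCharIdeal_eq)
    (hp : p ≠ 2) (hX : ClassX7 W p) (hap : W.frobeniusTrace p = 0) (hs : Surj W p)
    (hram : 5 ≤ p ∨ Ram W p) (h1 : W.analyticRank = 1)
    [NeZero (W.conductorNorm ℤ)] {f₀ : CuspForm (Gamma0 (W.conductorNorm ℤ)) 2} (hf₀ : IsNewformOf W f₀)
    {n : ℕ} (hn : Even n) {Θ : IwasawaAlgebra p}
    (hΘ : iwasawaToPowerSeries p Θ =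
      ((mazurTateElement f₀ p n).map (algebraMap ℚ ℚ_[p]) : PowerSeries ℚ_[p]))
    (hΘ0 : Θ ≠ 0) (hμ : mu Θ = 0) (hlam : lam Θ = (cyclotomicOmegaMinus p n).natDegree + 1)
    (hlt : lam Θ < p ^ n) : BSDp W p :=
  bsdp_of_mazurTate_even_of_corA5_of_analyticRank_eq_one_of_tower W p h12 h41 h5 h3 hGZK hmod hA5 hp
    hX.1.1 hap (towerSurj_of_surj_of_five_le_or_ram W p hs hram) h1 hf₀ hn hΘ hΘ0 hμ hlam hlt

/-- **X7 ∧ `r_an = 1` ∧ odd `p` ∧ `a_p = 0`, tower given: Kobayashi's main conjecture for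
`(E, p, ε)` at the pair from the λ-certificate** (`X7.kobayashiMainConjecture_of_lam_eq_one_…`,
p213197, without Lemma 20; certificate at the conductor level). PER PAIR.
[cite: Kobayashi2003, Thm. 1.2, Thm. 4.1 and Conjecture (p. 2)] [cite: GreenbergVatsal2000, p. 4 and §3 Remark 3.4] -/
theorem X7.kobayashiMainConjecture_of_cert_at_conductor_of_analyticRank_eq_one_of_tower
    (h12 : Kobayashi2003.thm12_signedSelmerDual_finite_torsion)
    (h41 : Kobayashi2003.thm41_signedCharIdeal_divisibility)
    (h5 : realPeriodRat_eq_unit_mul_plusPeriod) (h3 : realPeriodRat_eq_unit_mul_plusPeriod_three)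
    (hGZK : rank_eq_analyticRank_of_analyticRank_le_one)
    (hp : p ≠ 2) (hX : ClassX7 W p) (hap : W.frobeniusTrace p = 0)
    (htower : ∀ m : ℕ, W.HasSurjectiveModNGaloisRep (p ^ m : ℕ)) (h1 : W.analyticRank = 1) (ε : ℤˣ)
    [NeZero (W.conductorNorm ℤ)] {f₀ : CuspForm (Gamma0 (W.conductorNorm ℤ)) 2} (hf₀ : IsNewformOf W f₀)
    (hcert₀ : ∀ L : IwasawaAlgebra p, IsSignedPAdicLFunction f₀ p ε L → mu L = 0 ∧ lam L = 1) :
    KobayashiMainConjecture W p ε :=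
  _root_.Summit.BirchSwinnertonDyer.Rank1Residual.Supersingular.kobayashiMainConjecture_of_cert_at_conductor_of_analyticRank_eq_one_of_tower
    W p h12 h41 h5 h3 hGZK hp hX.1.1 hap htower h1 ε hf₀ hcert₀

/-- **X6 ∧ `r_an = 1` ∧ odd `p`, sign `ε = −1`: `BSD(E,p)` from ONE odd-level Mazur–Tate certificate,
granted `hmod'` (`exists_isNewformOf`) + Ribet–Diamond (`hLL`) instead of Lemma 20** — on X6 at an odd
prime `a_p = 0` (`ClassX6.frobeniusTrace_eq_zero`) and surj(p) (`ClassX6.surj`) are automatic, and the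
tower comes from Serre at `p ≥ 5` and from (ram@3) — a THEOREM for semistable curves with `E[3]`
irreducible (`ram_of_semistable_of_irr_of_le_seven`, `ClassX6.irr`) — at `p = 3`. PER PAIR.
[cite: BurungaleKobayashiOta2023, App. A Cor. A.5] [cite: Kobayashi2003, Thm. 7.4, Thm. 1.2, Thm. 4.1 and Conjecture (p. 2)]
[cite: Ribet1990, Thm. 1.1] [cite: Diamond1995RefinedSerre, Thm. 1.1] [cite: Serre1972, §5.4 Prop. 21 i)] -/
theorem X6.bsdp_of_mazurTate_odd_of_corA5_of_analyticRank_eq_one_of_levelLowering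
    (h12 : Kobayashi2003.thm12_signedSelmerDual_finite_torsion)
    (h41 : Kobayashi2003.thm41_signedCharIdeal_divisibility)
    (h5 : realPeriodRat_eq_unit_mul_plusPeriod) (h3 : realPeriodRat_eq_unit_mul_plusPeriod_three)
    (hGZK : rank_eq_analyticRank_of_analyticRank_le_one) (hmod : hasEntireLFunction_rat)
    (hmod' : exists_isNewformOf) (hLL : Literature.NumberTheory.Automorphic.diamond1995_refinedSerre)
    (hA5 : corA5_pPart_of_signedCharIdeal_eq)
    (hp : p ≠ 2) (hX : ClassX6 W p) (h1 : W.analyticRank = 1)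
    [NeZero (W.conductorNorm ℤ)] {f₀ : CuspForm (Gamma0 (W.conductorNorm ℤ)) 2} (hf₀ : IsNewformOf W f₀)
    {n : ℕ} (hn : Odd n) {Θ : IwasawaAlgebra p}
    (hΘ : iwasawaToPowerSeries p Θ =
      ((mazurTateElement f₀ p n).map (algebraMap ℚ ℚ_[p]) : PowerSeries ℚ_[p]))
    (hΘ0 : Θ ≠ 0) (hμ : mu Θ = 0) (hlam : lam Θ = (cyclotomicOmegaPlus p n).natDegree + 1)
    (hlt : lam Θ < p ^ n) : BSDp W p := by
  have hs : Surj W p := ClassX6.surj W p hp hX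
  have hram : 5 ≤ p ∨ Ram W p := by
    rcases hX.2.2 with h5p | _
    · exact Or.inl h5p
    · by_cases h5p : 5 ≤ p
      · exact Or.inl h5p
      · have hp7 : p ≤ 7 := by omega
        exact Or.inr (ram_of_semistable_of_irr_of_le_seven hmod' hLL W p hp hp7 hX.2.1
          (ClassX6.irr W p hp hX))
  exact bsdp_of_mazurTate_odd_of_corA5_of_analyticRank_eq_one_of_tower W p h12 h41 h5 h3 hGZK hmod hA5 hp
    hX.1.1 (ClassX6.frobeniusTrace_eq_zero W p hp hX) (towerSurj_of_surj_of_five_le_or_ram W p hs hram)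
    h1 hf₀ hn hΘ hΘ0 hμ hlam hlt

end Classes

end Summit.BirchSwinnertonDyer.Rank1Residual.Supersingular

end
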